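import Summits.Ventures.PercRepro.ConnD
import Summits.Ventures.PercRepro.C011

/-!
# Lemma B⁺ on the faces of ONE marked graph ⇒ C-011 for that graph at every `p`

typer-2's `C011_of_LemmaBPlus` (C011.lean) uses the class-level Lemma B⁺ only on the faces of the
graph at hand: `Φ⁺(G, p) = Σ_{v ≤ u} w(u) w(v) · (g − b − n_xR)(u, v)` (two-copy face grouping), so
`b + n_xR ≤ g` on every face `[v, u]` of the cube of `G` gives `Φ⁺(G, p) ≥ 0` for EVERY `p ∈ [0,1]^E`
— a statement about one graph and all weights.  This file states that per-graph face condition in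
a computable form and proves the transport:

* `row4D` is the computable row of the marked partition (`row4D_eq_row4`, through p6's
  breadth-first `connD`); a face `[v, u]` is an interval of the full cube paired with the antipode
  `antipode u v` (`antipode_embed`, `embed_restrict_of_le`); the integer face slack
  `faceSlackZ = g − b − n_xR` (`faceSlackZ_eq_sum_face`, `faceSlackZ_cast`, through typer-2's
  `sum_phiPlusKernel_compl`); `FacesBPlus G m` is the face condition (`facesBPlus_iff`);
* **`phiPlus_nonneg_of_facesBPlus`**, **`c011_of_facesBPlus`**, **`c005_of_facesBPlus`**: the face
  condition of `G` gives the `C011` / `C005` row inequality for `G` at every `p` (the argument of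
  `C011_of_LemmaBPlus`, for one graph).

`LemmaBPlusCodes.lean` turns the face condition into a single kernel computation on bit codes;
`LemmaBPlusKernel.lean` decides it for concrete graphs.
-/

namespace PercRepro

namespace MultiGraph

variable {V E : Type*} (G : MultiGraph V E) [DecidableEq V] [Fintype V] [Fintype E] [DecidableEq E]

/-- Computable row (`rgs4` index) of the marked partition of four marks: `rowOf4` of the six
connection atoms in the order `pair4` (`01, 02, 03, 12, 13, 23`), each decided by p6's
breadth-first `connD` (kernel-cheap). -/
def row4D (m : Fin 4 → V) (ω : Config E) : Fin 15 :=
  rowOf4 fun a => G.connD ω (m (pair4 a).1) (m (pair4 a).2)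

omit [DecidableEq E] in
/-- The computable row is `row4` of the marked partition. -/
theorem row4D_eq_row4 (m : Fin 4 → V) (ω : Config E) :
    G.row4D m ω = row4 (G.markedPartition ω m) := by
  unfold row4D row4
  congr 1
  funext a
  rw [atoms4_markedPartition, connD_eq_decide]
  exact decide_eq_decide.mpr Iff.rfl

/-! ### Faces as intervals of the full cube: the antipode and the integer face slack -/

/-- The antipode of `ω` inside the interval `[v, u]`: the face edges (open in `u`, closed in `v`)
are flipped, the sure edges of `v` stay open, the edges closed in `u` stay closed. -/
def antipode (u v ω : Config E) : Config E :=
  fun e => if v e then true else if u e then !ω e else false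

omit [DecidableEq V] [Fintype V] [Fintype E] [DecidableEq E] in
/-- The antipode of an embedded face point is the embedded complement. -/
theorem antipode_embed (u v : Config E) (ρ : Config (Face u v)) :
    antipode u v (embed u v ρ) = embed u v ρᶜ := by
  funext e
  by_cases h : v e = false ∧ u e = true
  · rw [embed_apply_of_mem u v ρᶜ h, Pi.compl_apply]
    simp [antipode, embed_apply_of_mem u v ρ h, h.1, h.2]
  · rw [embed_apply_of_not u v ρᶜ h]
    simp only [antipode, embed_apply_of_not u v ρ h]
    revert h
    cases v e <;> cases u e <;> simp

omit [DecidableEq V] [Fintype V] [Fintype E] [DecidableEq E] in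
/-- A point of the interval `[v, u]` is the embedding of its restriction. -/
theorem embed_restrict_of_le {u v ω : Config E} (hv : v ≤ ω) (hu : ω ≤ u) :
    embed u v (restrict u v ω) = ω := by
  funext e
  by_cases h : v e = false ∧ u e = true
  · rw [embed_apply_of_mem u v _ h]
    rfl
  · rw [embed_apply_of_not u v _ h]
    have hv' := Config.le_iff.mp hv e
    have hu' := Config.le_iff.mp hu e
    revert h hv' hu'
    cases v e <;> cases u e <;> cases ω e <;> simp

omit [DecidableEq V] [Fintype V] [Fintype E] [DecidableEq E] in
/-- The embedded complement of the restriction is the antipode. -/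
theorem embed_restrict_compl_of_le {u v ω : Config E} (hv : v ≤ ω) (hu : ω ≤ u) :
    embed u v (restrict u v ω)ᶜ = antipode u v ω := by
  rw [← antipode_embed, embed_restrict_of_le hv hu]

omit [DecidableEq V] [Fintype V] [Fintype E] [DecidableEq E] in
/-- An embedded face point lies above `v`. -/
theorem le_embed' (u v : Config E) (ρ : Config (Face u v)) : v ≤ embed u v ρ := by
  rw [Config.le_iff]
  intro e he
  have h : ¬ (v e = false ∧ u e = true) := fun h => by simp [he] at h
  rw [embed_apply_of_not u v ρ h, he]

omit [DecidableEq V] [Fintype V] [Fintype E] [DecidableEq E] in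
/-- An embedded face point lies below `u` when `v ≤ u`. -/
theorem embed_le' {u v : Config E} (hvu : v ≤ u) (ρ : Config (Face u v)) : embed u v ρ ≤ u := by
  rw [Config.le_iff]
  intro e he
  by_cases h : v e = false ∧ u e = true
  · exact h.2
  · rw [embed_apply_of_not u v ρ h] at he
    exact Config.le_iff.mp hvu e he

/-- The integer row kernel of `Φ⁺`: `[s = ⊤ ∧ t = ⊥] − [(s, t) crossing] − [(s, t) liability]`
(the integer twin of `phiPlusKernel`). -/
def phiPlusKernelZ (s t : Fin 15) : ℤ :=
  (if s = 0 ∧ t = 14 then 1 else 0) - (if (s, t) ∈ crossPairs4 then 1 else 0) -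
    if (s, t) ∈ liabPairs4 then 1 else 0

omit [DecidableEq V] [Fintype V] [Fintype E] [DecidableEq E] in
/-- The integer kernel casts to the real one. -/
theorem phiPlusKernelZ_cast (s t : Fin 15) : ((phiPlusKernelZ s t : ℤ) : ℝ) = phiPlusKernel s t := by
  have key : ∀ S : Finset (Fin 15 × Fin 15),
      (∑ q ∈ S, if s = q.1 ∧ t = q.2 then (1 : ℝ) else 0) = if (s, t) ∈ S then 1 else 0 := by
    intro S
    rw [← Finset.sum_ite_eq' S (s, t) (fun _ => (1 : ℝ))]
    refine Finset.sum_congr rfl fun q _ => ?_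
    simp only [Prod.ext_iff, eq_comm]
  unfold phiPlusKernelZ phiPlusKernel
  rw [key, key]
  push_cast
  rfl

/-- **The integer face slack** `g − b − n_xR` of the face `[v, u]`, computed on the full cube:
the sum of the integer kernel over the points `ω` of the interval, paired with their antipodes. -/
def faceSlackZ (m : Fin 4 → V) (u v : Config E) : ℤ :=
  ∑ ω ∈ Finset.univ.filter (fun ω : Config E => v ≤ ω ∧ ω ≤ u),
    phiPlusKernelZ (G.row4D m ω) (G.row4D m (antipode u v ω))

/-- The face slack as a sum over the face cube (the form of `sum_phiPlusKernel_compl`). -/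
theorem faceSlackZ_eq_sum_face (m : Fin 4 → V) {u v : Config E} (hvu : v ≤ u) :
    G.faceSlackZ m u v = ∑ ρ : Config (Face u v),
      phiPlusKernelZ (G.row4D m (embed u v ρ)) (G.row4D m (embed u v ρᶜ)) := by
  unfold faceSlackZ
  symm
  refine Finset.sum_bij' (fun ρ _ => embed u v ρ) (fun ω _ => restrict u v ω) ?_ ?_ ?_ ?_ ?_
  · intro ρ _
    exact Finset.mem_filter.mpr ⟨Finset.mem_univ _, le_embed' u v ρ, embed_le' hvu ρ⟩
  · intro ω _
    exact Finset.mem_univ _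
  · intro ρ _
    exact restrict_embed u v ρ
  · intro ω hω
    obtain ⟨_, hv, hu⟩ := Finset.mem_filter.mp hω
    exact embed_restrict_of_le hv hu
  · intro ρ _
    rw [antipode_embed]

/-- **The face slack is `g − b − n_xR`** of the row map `ρ ↦ row4 (Π(embed ρ))` of the face. -/
theorem faceSlackZ_cast (m : Fin 4 → V) {u v : Config E} (hvu : v ≤ u) :
    ((G.faceSlackZ m u v : ℤ) : ℝ) =
      (goodCount (fun ρ : Config (Face u v) => row4 (G.markedPartition (embed u v ρ) m)) : ℝ) -
        badCount (fun ρ : Config (Face u v) => row4 (G.markedPartition (embed u v ρ) m)) -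
        liabilityCount (fun ρ : Config (Face u v) => row4 (G.markedPartition (embed u v ρ) m)) := by
  rw [← sum_phiPlusKernel_compl, G.faceSlackZ_eq_sum_face m hvu]
  push_cast
  simp only [phiPlusKernelZ_cast, row4D_eq_row4]

/-- **Lemma B⁺ on the faces of `G`** (the per-graph hypothesis of `C011_of_LemmaBPlus`), in
computable form: every face `[v, u]` of the cube has nonnegative integer slack `g − b − n_xR`. -/
def FacesBPlus (m : Fin 4 → V) : Prop :=
  ∀ u v : Config E, v ≤ u → 0 ≤ G.faceSlackZ m u v

/-- The face condition is decidable on finite data. -/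
instance (m : Fin 4 → V) : Decidable (G.FacesBPlus m) := by
  unfold FacesBPlus; infer_instance

/-- The face condition in the vocabulary of `LemmaBPlus` (rows `row4 ∘ markedPartition`, counts
`g`, `b`, `n_xR`). -/
theorem facesBPlus_iff (m : Fin 4 → V) :
    G.FacesBPlus m ↔ ∀ u v : Config E, v ≤ u →
      badCount (fun ρ : Config (Face u v) => row4 (G.markedPartition (embed u v ρ) m)) +
          liabilityCount (fun ρ : Config (Face u v) => row4 (G.markedPartition (embed u v ρ) m)) ≤
        goodCount (fun ρ : Config (Face u v) => row4 (G.markedPartition (embed u v ρ) m)) := by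
  unfold FacesBPlus
  refine forall_congr' fun u => forall_congr' fun v => forall_congr' fun hvu => ?_
  have h := G.faceSlackZ_cast m hvu
  constructor
  · intro h0
    have : (0 : ℝ) ≤ (G.faceSlackZ m u v : ℤ) := by exact_mod_cast h0
    rw [h] at this
    exact_mod_cast (by linarith : ((badCount _ : ℕ) : ℝ) + liabilityCount _ ≤ goodCount _)
  · intro hle
    have : ((badCount (fun ρ : Config (Face u v) => row4 (G.markedPartition (embed u v ρ) m)) +
        liabilityCount (fun ρ : Config (Face u v) => row4 (G.markedPartition (embed u v ρ) m)) : ℕ) : ℝ) ≤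
        goodCount (fun ρ : Config (Face u v) => row4 (G.markedPartition (embed u v ρ) m)) := by
      exact_mod_cast hle
    push_cast at this
    have : (0 : ℝ) ≤ (G.faceSlackZ m u v : ℤ) := by rw [h]; linarith
    exact_mod_cast this

end MultiGraph

namespace MultiGraph

variable {V E : Type*} (G : MultiGraph V E) [DecidableEq V] [Fintype V] [Fintype E] [DecidableEq E]

/-- **The slack `Φ⁺` of `G` is nonnegative at every `p`** once Lemma B⁺ holds on the faces of `G`
(the argument of `C011_of_LemmaBPlus`, for one graph). -/
theorem phiPlus_nonneg_of_facesBPlus (a b c d : V) (h : G.FacesBPlus ![a, b, c, d])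
    (p : E → ℝ) (hp : IsProb p) : 0 ≤ G.PhiPlus p a b c d := by
  rw [G.facesBPlus_iff] at h
  rw [G.phiPlus_eq_twoCopy, twoCopy_eq_sum_faces p
    (fun ω => row4 (G.markedPartition ω ![a, b, c, d])) phiPlusKernel]
  refine Finset.sum_nonneg fun uv _ => ?_
  refine mul_nonneg (mul_nonneg (weight_nonneg hp _) (weight_nonneg hp _)) ?_
  split_ifs with hle
  · have key := h uv.1 uv.2 hle
    have hs := sum_phiPlusKernel_compl
      (fun ρ : Config (Face uv.1 uv.2) => row4 (G.markedPartition (embed uv.1 uv.2 ρ) ![a, b, c, d]))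
    rw [hs]
    have : ((badCount (fun ρ : Config (Face uv.1 uv.2) =>
        row4 (G.markedPartition (embed uv.1 uv.2 ρ) ![a, b, c, d])) +
        liabilityCount (fun ρ : Config (Face uv.1 uv.2) =>
          row4 (G.markedPartition (embed uv.1 uv.2 ρ) ![a, b, c, d])) : ℕ) : ℝ) ≤
        (goodCount (fun ρ : Config (Face uv.1 uv.2) =>
          row4 (G.markedPartition (embed uv.1 uv.2 ρ) ![a, b, c, d])) : ℝ) := by
      exact_mod_cast key
    push_cast at this
    linarith
  · exact le_rfl

/-- **C-011 for `G` at every `p`** from the face condition: the row inequality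
`x₁x₂ + x₁x₃ + x₂x₃ + Σ_{i ≠ j} x_i r_j ≤ top · bot` of `C011`, for the marks `a b c d` of `G`. -/
theorem c011_of_facesBPlus (a b c d : V) (h : G.FacesBPlus ![a, b, c, d])
    (p : E → ℝ) (hp : IsProb p) :
    G.law4 p a b c d 3 * G.law4 p a b c d 6 + G.law4 p a b c d 3 * G.law4 p a b c d 8 +
        G.law4 p a b c d 6 * G.law4 p a b c d 8 + G.liabilitySum p a b c d ≤
      G.law4 p a b c d 0 * G.law4 p a b c d 14 := by
  have := G.phiPlus_nonneg_of_facesBPlus a b c d h p hp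
  unfold PhiPlus at this
  linarith

/-- **C-005 for `G` at every `p`** from the face condition (drop the liability terms). -/
theorem c005_of_facesBPlus (a b c d : V) (h : G.FacesBPlus ![a, b, c, d])
    (p : E → ℝ) (hp : IsProb p) :
    G.law4 p a b c d 3 * G.law4 p a b c d 6 + G.law4 p a b c d 3 * G.law4 p a b c d 8 +
        G.law4 p a b c d 6 * G.law4 p a b c d 8 ≤
      G.law4 p a b c d 0 * G.law4 p a b c d 14 := by
  have := G.c011_of_facesBPlus a b c d h p hp
  have hl := G.liabilitySum_nonneg hp a b c d
  linarith

end MultiGraph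

end PercRepro
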